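import Literature.NumberTheory.Transcendental.KZProductIdeal
import Literature.NumberTheory.Transcendental.KZSemiCanonicalReductionProofs
import Literature.NumberTheory.Transcendental.KZCubicalCalculus
import Literature.NumberTheory.Transcendental.KZRelationsLE
import Summits.KontsevichZagierPeriods.KontsevichZagierPeriods.Theorems.MzvKernelInKZ.Negative.ScalingDivision
import Summits.KontsevichZagierPeriods.KontsevichZagierPeriods.Theorems.VietaFibreKernelFormStubBoundedDecomposition
import Summits.KontsevichZagierPeriods.KontsevichZagierPeriods.Theorems.VietaFibreKernelFormStubRationalBox
import Summits.KontsevichZagierPeriods.KontsevichZagierPeriods.Theorems.VietaFibreKernelFormStubCubeMul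
import HarnessLib

/-!
# Crux `KernelForm` (stmt-KontsevichZagierPeriods-10447), line `Sketch`: the CANCELLER NORMAL FORM

`Cancellation := ∀ c s, KZ.eval s ≠ 0 → s * c ∈ KZ.relations → c ∈ KZ.relations` is the geometric
half of the cut `KernelForm ↔ WeakKernel ∧ Cancellation` (file `VietaFibreKernelFormCut.lean`).
This file proves, unconditionally, that cancellers can be normalised:

* `cancellerNormalForm` — if `s * c ∈ KZ.relations` with `KZ.eval s ≠ 0`, then for every `ε > 0`
  there are a compact `ℚ`-semialgebraic `K ⊆ ℝ^{k+1}` with non-empty interior and a rational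
  `κ > 0` such that `[K, κ]` has value `< ε` and `c + [K, κ] * c ∈ KZ.relations`
  (every canceller can be replaced by `1 + t`, `t` an arbitrarily thin effective class).

Proof (`cancellerNormalForm_of_pos`): decompose `s ≡ [A] − [B]` into bounded volume forms of one
dimension (`stub_boundedDecomposition`), pack `[A] − [B] ≡ [K₁]` inside the rules (Viu-Sos,
`KZ.exists_isCompact_of_sub_of_sub_mem_relations`), choose a rational `a/b` with
`v/(1+ε) < a/b < v = eval s` and pack again `[K₁] − [box a/b] ≡ [K₂]`, trade `b` boxes for `a` unit
cubes (`stub_rationalBox`), let the unit cube act as the identity (`stub_cubeMul`), rescale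
`b • [K₂] ≡ a • [K₂, b/a]` (`ScalingDivision`) and divide by `a` (`mem_relations_of_nsmul_mem`).
All statements are inline over the calculus (no new definitions).

References: M. Kontsevich, D. Zagier, *Periods* (2001), §1.2 (rules), §4.1 (products);
J. Viu-Sos, *A semi-canonical reduction for periods of Kontsevich–Zagier*, IJNT 17 (2021), §4
[ViuSos2021].
-/

noncomputable section

open MeasureTheory Set
open Literature.NumberTheory.Transcendental
open Literature.ModelTheory.ExponentialFields (IsSemialgebraic)

namespace Summit.KontsevichZagierPeriods.KernelForm.LocaliseAtValuePrime

/-! ### The rational box `[0, a/b] × [0,1]^k` -/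

/-- The rational box `[0, a/b] × [0,1]^k ⊆ ℝ^{k+1}` is `ℚ`-semialgebraic. [folklore] -/
theorem isSemialgebraic_rationalBoxSet (k a b : ℕ) :
    IsSemialgebraic ℚ {x : Fin (k + 1) → ℝ | (0 ≤ x 0 ∧ x 0 ≤ (a : ℝ) / b) ∧ ∀ i, i ≠ 0 → 0 ≤ x i ∧ x i ≤ 1} := by
  have h0a : IsSemialgebraic ℚ {x : Fin (k + 1) → ℝ | 0 ≤ x 0} := by
    simpa using Literature.ModelTheory.ExponentialFields.isSemialgebraic_setOf_eval_le (k := ℚ)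
      (R := ℝ) (0 : MvPolynomial (Fin (k + 1)) ℚ) (MvPolynomial.X 0)
  have h0b : IsSemialgebraic ℚ {x : Fin (k + 1) → ℝ | x 0 ≤ (a : ℝ) / b} := by
    simpa using Literature.ModelTheory.ExponentialFields.isSemialgebraic_setOf_eval_le (k := ℚ)
      (R := ℝ) (MvPolynomial.X 0 : MvPolynomial (Fin (k + 1)) ℚ) (MvPolynomial.C ((a : ℚ) / b))
  have h1 : IsSemialgebraic ℚ (⋂ i ∈ (Finset.univ.erase (0 : Fin (k + 1))),
      ({x : Fin (k + 1) → ℝ | 0 ≤ x i} ∩ {x | x i ≤ 1})) := by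
    refine Literature.ModelTheory.ExponentialFields.IsSemialgebraic.biInter _ _ fun i _ => ?_
    have h1 : IsSemialgebraic ℚ {x : Fin (k + 1) → ℝ | 0 ≤ x i} := by
      simpa using Literature.ModelTheory.ExponentialFields.isSemialgebraic_setOf_eval_le (k := ℚ)
        (R := ℝ) (0 : MvPolynomial (Fin (k + 1)) ℚ) (MvPolynomial.X i)
    have h2 : IsSemialgebraic ℚ {x : Fin (k + 1) → ℝ | x i ≤ 1} := by
      simpa using Literature.ModelTheory.ExponentialFields.isSemialgebraic_setOf_eval_le (k := ℚ)
        (R := ℝ) (MvPolynomial.X i : MvPolynomial (Fin (k + 1)) ℚ) 1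
    exact h1.inter h2
  have hset : {x : Fin (k + 1) → ℝ | (0 ≤ x 0 ∧ x 0 ≤ (a : ℝ) / b) ∧ ∀ i, i ≠ 0 → 0 ≤ x i ∧ x i ≤ 1} =
      ({x : Fin (k + 1) → ℝ | 0 ≤ x 0} ∩ {x | x 0 ≤ (a : ℝ) / b}) ∩
      ⋂ i ∈ (Finset.univ.erase (0 : Fin (k + 1))), ({x : Fin (k + 1) → ℝ | 0 ≤ x i} ∩ {x | x i ≤ 1}) := by
    ext x
    simp only [mem_setOf_eq, mem_inter_iff, mem_iInter, Finset.mem_erase, Finset.mem_univ,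
      and_true, ne_eq]
  rw [hset]
  exact (h0a.inter h0b).inter h1

/-- The rational box `[0, a/b] × [0,1]^k` is bounded. [folklore] -/
theorem isBounded_rationalBoxSet (k a b : ℕ) :
    Bornology.IsBounded {x : Fin (k + 1) → ℝ | (0 ≤ x 0 ∧ x 0 ≤ (a : ℝ) / b) ∧ ∀ i, i ≠ 0 → 0 ≤ x i ∧ x i ≤ 1} := by
  refine (Metric.isBounded_Icc (0 : Fin (k + 1) → ℝ) (fun _ => max ((a : ℝ) / b) 1)).subset ?_
  intro x hx
  simp only [mem_setOf_eq] at hx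
  refine ⟨fun i => ?_, fun i => ?_⟩
  · by_cases hi : i = 0
    · subst hi; exact hx.1.1
    · exact (hx.2 i hi).1
  · by_cases hi : i = 0
    · subst hi; exact hx.1.2.trans (le_max_left _ _)
    · exact (hx.2 i hi).2.trans (le_max_right _ _)

/-! ### The canceller normal form -/

/-- A relation evaluates to zero (soundness, repackaged). [folklore] -/
theorem eval_eq_zero_of_mem {c : KZ.FormalRep} (h : c ∈ KZ.relations) : KZ.eval c = 0 :=
  KZ.relations_le_ker_eval_holds h

/-- `(n • x) * c = n • (x * c)` in the (non-unital, non-associative) ring `KZ.FormalRep`. [folklore] -/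
theorem nsmul_mul (n : ℕ) (x c : KZ.FormalRep) : (n • x) * c = n • (x * c) := by
  induction n with
  | zero => simp
  | succ m ih => rw [succ_nsmul, succ_nsmul, add_mul, ih]

/-- **The canceller normal form for a canceller of positive value.** From `s * c ∈ relations`,
`0 < eval s`: decompose `s ≡ [A] − [B]` into bounded volume forms (`stub_boundedDecomposition`),
pack `[A] − [B] ≡ [K₁]` (Viu-Sos, `KZ.exists_isCompact_of_sub_of_sub_mem_relations`), choose a
rational `a/b` with `v/(1+ε) < a/b < v = eval s`, pack again `[K₁] − [box a/b] ≡ [K₂]`, trade the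
box for `a/b` unit cubes (`stub_rationalBox`), let the cube act as the identity (`stub_cubeMul`),
rescale `b • [K₂] ≡ a • [K₂, b/a]` and divide by `a` (`mem_relations_of_nsmul_mem`).
[cite: ViuSos2021, §4] [folklore] -/
theorem cancellerNormalForm_of_pos (c s : KZ.FormalRep) (hv : 0 < KZ.eval s)
    (hsc : s * c ∈ KZ.relations) (ε : ℝ) (hε : 0 < ε) :
    ∃ (k : ℕ) (K : KZ.IntegralRep (k + 1)) (κ : ℚ), 0 < κ ∧ IsCompact K.domain ∧
      (interior K.domain).Nonempty ∧ (∀ x ∈ K.domain, K.integrand x = κ) ∧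
      KZ.eval (KZ.of K) < ε ∧ c + KZ.of K * c ∈ KZ.relations := by
  set v := KZ.eval s with hv_def
  -- (1) bounded decomposition `s ≡ [A] − [B]`
  obtain ⟨k, A, B, hAb, hBb, hA1, hB1, hsAB⟩ := stub_boundedDecomposition s
  have hvAB : v = A.value - B.value := by
    have h := eval_eq_zero_of_mem hsAB
    simp only [map_sub, KZ.eval_of] at h
    linarith
  -- (2) `([A] − [B]) * c ∈ relations`
  have h1 : (KZ.of A - KZ.of B) * c ∈ KZ.relations := by
    have h := KZ.mul_mem_relations_right_holds _ c hsAB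
    rw [sub_mul] at h
    have : (KZ.of A - KZ.of B) * c = s * c - (s * c - (KZ.of A - KZ.of B) * c) := by abel
    rw [this]
    exact KZ.relations.sub_mem hsc h
  -- (3) packing `[A] − [B] ≡ [K₁]`
  obtain ⟨K₁, hK₁c, -, hK₁1, hABK₁⟩ :=
    KZ.exists_isCompact_of_sub_of_sub_mem_relations A B hAb hBb hA1 hB1 (by linarith)
  have hK₁v : K₁.value = v := by
    have h := eval_eq_zero_of_mem hABK₁
    simp only [map_sub, KZ.eval_of] at h
    linarith
  have h2 : KZ.of K₁ * c ∈ KZ.relations := by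
    have h := KZ.mul_mem_relations_right_holds _ c hABK₁
    rw [sub_mul] at h
    have : KZ.of K₁ * c = (KZ.of A - KZ.of B) * c - ((KZ.of A - KZ.of B) * c - KZ.of K₁ * c) := by
      abel
    rw [this]
    exact KZ.relations.sub_mem h1 h
  -- (4) a rational `ρ = a / b` with `v / (1 + ε) < ρ < v`
  obtain ⟨ρ, hρ₁, hρ₂⟩ := exists_rat_btwn (show v / (1 + ε) < v from div_lt_self hv (by linarith))
  have hρpos : (0 : ℝ) < ρ := lt_trans (div_pos hv (by linarith)) hρ₁
  have hρpos' : (0 : ℚ) < ρ := by exact_mod_cast hρpos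
  set a : ℕ := ρ.num.toNat with ha_def
  set b : ℕ := ρ.den with hb_def
  have ha : 0 < a := by
    rw [ha_def]
    have := Rat.num_pos.mpr hρpos'
    omega
  have hb : 0 < b := ρ.den_pos
  have hab : (ρ : ℝ) = (a : ℝ) / b := by
    have hnum : ((a : ℕ) : ℤ) = ρ.num := by
      rw [ha_def]; exact Int.toNat_of_nonneg (Rat.num_pos.mpr hρpos').le
    have : (ρ : ℚ) = (a : ℚ) / b := by
      rw [hb_def]
      conv_lhs => rw [← Rat.num_div_den ρ]
      congr 1
      exact_mod_cast hnum.symm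
    rw [this]; push_cast; rfl
  -- (5) the box `R = [0, a/b] × [0,1]^k` and the unit cube `U`
  obtain ⟨R, hRd, hRi⟩ := KZ.exists_oneRep (isSemialgebraic_rationalBoxSet k a b)
    ((isBounded_rationalBoxSet k a b).measure_lt_top).ne
  obtain ⟨U, hUd, hUi⟩ := KZ.exists_oneRep (KZ.isSemialgebraic_cube (n := k + 1))
    (by simp [KZ.volume_cube])
  have hRb : Bornology.IsBounded R.domain := hRd ▸ isBounded_rationalBoxSet k a b
  have hRU : b • KZ.of R - a • KZ.of U ∈ KZ.relations :=
    stub_rationalBox k a b R U ha hb hRd hRi hUd hUi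
  have hUv : U.value = 1 := by
    rw [KZ.IntegralRep.value_eq_volume_real U (fun x _ => by rw [hUi]), hUd, KZ.volume_real_cube]
  have hRv : R.value = ρ := by
    have h := eval_eq_zero_of_mem hRU
    simp only [map_sub, map_nsmul, KZ.eval_of, hUv, nsmul_eq_mul, mul_one] at h
    rw [hab, eq_div_iff (by exact_mod_cast hb.ne')]
    linarith
  -- (6) packing `[K₁] − [R] ≡ [K₂]`
  obtain ⟨K₂, hK₂c, hK₂i, hK₂1, hK₁RK₂⟩ :=
    KZ.exists_isCompact_of_sub_of_sub_mem_relations K₁ R hK₁c.isBounded hRb hK₁1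
      (fun x _ => by rw [hRi]) (by rw [hK₁v, hRv]; exact hρ₂)
  have hK₂v : K₂.value = v - ρ := by
    have h := eval_eq_zero_of_mem hK₁RK₂
    simp only [map_sub, KZ.eval_of] at h
    linarith
  -- (7) ideal chase: `a • c + b • [K₂] * c ∈ relations`
  have h3 : KZ.of R * c + KZ.of K₂ * c ∈ KZ.relations := by
    have h := KZ.mul_mem_relations_right_holds _ c hK₁RK₂
    rw [sub_mul, sub_mul] at h
    have : KZ.of R * c + KZ.of K₂ * c = KZ.of K₁ * c - (KZ.of K₁ * c - KZ.of R * c - KZ.of K₂ * c) := by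
      abel
    rw [this]
    exact KZ.relations.sub_mem h2 h
  have h4 : a • (KZ.of U * c) + b • (KZ.of K₂ * c) ∈ KZ.relations := by
    have h := KZ.mul_mem_relations_right_holds _ c hRU
    rw [sub_mul, nsmul_mul, nsmul_mul] at h
    have h' := KZ.relations.nsmul_mem h3 b
    rw [nsmul_add] at h'
    have : a • (KZ.of U * c) + b • (KZ.of K₂ * c) =
        b • (KZ.of R * c) + b • (KZ.of K₂ * c) - (b • (KZ.of R * c) - a • (KZ.of U * c)) := by abel
    rw [this]
    exact KZ.relations.sub_mem h' h
  have h5 : a • c + b • (KZ.of K₂ * c) ∈ KZ.relations := by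
    have hU1 : KZ.of U * c - c ∈ KZ.relations := by
      have e : KZ.of U * c - c = (KZ.of U * c - c * KZ.of U) + (c * KZ.of U - c) := by abel
      rw [e]
      exact KZ.relations.add_mem (KZ.mul_sub_mul_comm_mem_relations _ _)
        (stub_cubeMul (k + 1) U c hUd hUi)
    have h := KZ.relations.nsmul_mem hU1 a
    rw [nsmul_sub] at h
    have : a • c + b • (KZ.of K₂ * c) =
        a • (KZ.of U * c) + b • (KZ.of K₂ * c) - (a • (KZ.of U * c) - a • c) := by abel
    rw [this]
    exact KZ.relations.sub_mem h4 h
  -- (8) `b • [K₂] ≡ a • [K']` with `K' = (b/a) · K₂`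
  have halg : IsAlgebraic ℚ ((b : ℝ) / a) := by
    have : ((((b : ℚ) / a : ℚ)) : ℝ) = (b : ℝ) / a := by push_cast; rfl
    rw [← this]; exact isAlgebraic_algebraMap _
  set K' : KZ.IntegralRep (k + 1) := K₂.constMul ((b : ℝ) / a) halg with hK'_def
  have h6 : b • KZ.of K₂ - a • KZ.of K' ∈ KZ.relations := by
    have e1 := Summit.KontsevichZagierPeriods.MzvKernelInKZ.Negative.of_constMul_nat_sub_nsmul_mem b K₂
    have e2 := Summit.KontsevichZagierPeriods.MzvKernelInKZ.Negative.of_constMul_nat_sub_nsmul_mem a K'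
    have e3 := Summit.KontsevichZagierPeriods.MzvKernelInKZ.Negative.scale_scale_of_sub_mem (a : ℝ)
      ((b : ℝ) / a) (Summit.KontsevichZagierPeriods.MzvKernelInKZ.Negative.isAlgebraic_natCast a) halg K₂
    have e4 : KZ.scale ((a : ℝ) * ((b : ℝ) / a))
        ((Summit.KontsevichZagierPeriods.MzvKernelInKZ.Negative.isAlgebraic_natCast a).mul halg)
        (KZ.of K₂) =
        KZ.scale (b : ℝ) (Summit.KontsevichZagierPeriods.MzvKernelInKZ.Negative.isAlgebraic_natCast b)
        (KZ.of K₂) :=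
      Summit.KontsevichZagierPeriods.MzvKernelInKZ.Negative.scale_congr _ _
        (mul_div_cancel₀ _ (by exact_mod_cast ha.ne')) _
    rw [e4, KZ.scale_of, KZ.scale_of, KZ.scale_of] at e3
    rw [hK'_def]
    -- `b • [K₂] − a • [K'] = −([bK₂] − b•[K₂]) + ([bK₂]... )` bookkeeping
    have : b • KZ.of K₂ - a • KZ.of (K₂.constMul ((b : ℝ) / a) halg) =
        -(KZ.of (K₂.constMul (b : ℝ) (Summit.KontsevichZagierPeriods.MzvKernelInKZ.Negative.isAlgebraic_natCast b)) - b • KZ.of K₂)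
        - (KZ.of ((K₂.constMul ((b : ℝ) / a) halg).constMul (a : ℝ)
            (Summit.KontsevichZagierPeriods.MzvKernelInKZ.Negative.isAlgebraic_natCast a))
          - KZ.of (K₂.constMul (b : ℝ) (Summit.KontsevichZagierPeriods.MzvKernelInKZ.Negative.isAlgebraic_natCast b)))
        + (KZ.of ((K₂.constMul ((b : ℝ) / a) halg).constMul (a : ℝ)
            (Summit.KontsevichZagierPeriods.MzvKernelInKZ.Negative.isAlgebraic_natCast a))
          - a • KZ.of (K₂.constMul ((b : ℝ) / a) halg)) := by abel
    rw [this]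
    exact KZ.relations.add_mem (KZ.relations.sub_mem (KZ.relations.neg_mem e1) e3) e2
  have h7 : a • (c + KZ.of K' * c) ∈ KZ.relations := by
    have h := KZ.mul_mem_relations_right_holds _ c h6
    rw [sub_mul, nsmul_mul, nsmul_mul] at h
    rw [nsmul_add]
    have : a • c + a • (KZ.of K' * c) =
        a • c + b • (KZ.of K₂ * c) - (b • (KZ.of K₂ * c) - a • (KZ.of K' * c)) := by abel
    rw [this]
    exact KZ.relations.sub_mem h5 h
  -- (9) integer division and the bookkeeping of `K'`
  refine ⟨k, K', (b : ℚ) / a, by positivity, ?_, ?_, fun x hx => ?_, ?_,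
    Summit.KontsevichZagierPeriods.MzvKernelInKZ.Negative.mem_relations_of_nsmul_mem ha h7⟩
  · simpa [hK'_def] using hK₂c
  · simpa [hK'_def] using hK₂i
  · rw [hK'_def, KZ.IntegralRep.integrand_constMul]
    simp only
    rw [hK₂1 x (by simpa [hK'_def] using hx)]
    push_cast; ring
  · rw [KZ.eval_of, hK'_def, KZ.IntegralRep.value_constMul, hK₂v]
    have hlt : v < (1 + ε) * ρ := by
      rwa [div_lt_iff₀ (by linarith), mul_comm] at hρ₁
    rw [hab] at hlt ⊢
    have hbpos : (0 : ℝ) < b := by exact_mod_cast hb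
    have hapos : (0 : ℝ) < a := by exact_mod_cast ha
    rw [div_mul_eq_mul_div, div_lt_iff₀ hapos]
    have : (b : ℝ) * (v - a / b) = b * v - a := by field_simp
    rw [this]
    have h' : (b : ℝ) * v < (1 + ε) * a := by
      have := mul_lt_mul_of_pos_left hlt hbpos
      rwa [show (b : ℝ) * ((1 + ε) * (a / b)) = (1 + ε) * a by field_simp] at this
    linarith

/-- **CANCELLER NORMAL FORM** (unconditional). If `s * c ∈ KZ.relations` for some formal
combination `s` of non-zero value, then for every `ε > 0` there is a compact `ℚ`-semialgebraic
`K ⊆ ℝ^{k+1}` with non-empty interior and a rational `κ > 0` such that the representation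
`[K, κ]` has value `< ε` and `c + [K, κ] * c ∈ KZ.relations`: every canceller can be replaced by
`1 + t` with `t` an arbitrarily thin effective class. Reduction to a canceller of positive value
by a sign change, then `cancellerNormalForm_of_pos`. [folklore] -/
theorem cancellerNormalForm :
    ∀ c s : KZ.FormalRep, KZ.eval s ≠ 0 → s * c ∈ KZ.relations → ∀ ε : ℝ, 0 < ε → ∃ (k : ℕ) (K : KZ.IntegralRep (k + 1)) (κ : ℚ), 0 < κ ∧ IsCompact K.domain ∧ (interior K.domain).Nonempty ∧ (∀ x ∈ K.domain, K.integrand x = κ) ∧ KZ.eval (KZ.of K) < ε ∧ c + KZ.of K * c ∈ KZ.relations := by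
  intro c s hs hsc ε hε
  rcases lt_or_gt_of_ne hs with hneg | hpos
  · refine cancellerNormalForm_of_pos c (-s) ?_ ?_ ε hε
    · rw [map_neg]; linarith
    · rw [neg_mul]; exact KZ.relations.neg_mem hsc
  · exact cancellerNormalForm_of_pos c s hpos hsc ε hε

end Summit.KontsevichZagierPeriods.KernelForm.LocaliseAtValuePrime
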